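import Summits.RiemannHypothesis.RiemannHypothesis.Theorems.SoloInformedScaleAdaptedTest
import Summits.RiemannHypothesis.RiemannHypothesis.Theorems.SoloInformedLatticeComb
import Summits.RiemannHypothesis.RiemannHypothesis.Theorems.SoloInformedZeroSide
import Summits.RiemannHypothesis.RiemannHypothesis.Theorems.SoloInformedGroundStateZeroSide
import Literature.NumberTheory.LFunctions.WeilGroundEnergyProofs
import HarnessLib

/-!
# T70 — under RH a comb pocket in the zeros forces exponentially small window energy

Write `ε(a) = weilGroundEnergy a` for the ground energy of Weil's quadratic form on the window
`[-a, a]`.  Call the zeros of `ζ` on the critical line near height `h` a COMB POCKET of radius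
`R`, spacing `π/τ` and width `u` if every ordinate `γ` with `|γ - h| ≤ R` lies within `u` of the
shifted lattice `h + (π/τ)ℤ`.  Then (`weilGroundEnergy_le_of_combPocket`):

  **RH ⟹ ∃ A > 0, ∀ a, τ, h, R, u with 1 ≤ τ ≤ a - 1, R ≥ A, u ≥ 0 and such a pocket,
  `ε(a) ≤ A · log(|h| + 2) · (1 + R²) · (a³ u² + e^{-R/A})`.**

So a pocket of radius `R` and width `u ≤ e^{-R}` at ANY height `h ≤ exp(e^{R/2A})` would push
`ε(a)` below `e^{-R/2A}`; read contrapositively, a lower size law `ε(a) ≥ exp(-e^{Ba})` (T68's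
conclusion under RH + anti-clustering) forbids comb pockets of radius `R ≥ 4AB·e^{Ba}`-ish and
exponentially small width below triple-exponential height.  The lower size law for `ε` under RH
is thereby bracketed between two statements about the local structure of the zeros: (AC*) of T68
implies it, and it implies "no comb pockets" — the exact model configuration on which the window
form is blind (T64 `exists_isWeilTest_vanishing_on_lattice`).

Proof.  Test vector `g(x) = e^{-ihx} (Φ(x + τ) - Φ(x - τ))` with `Φ` the scale-adapted test of
T70a on `[-1, 1]` at scale `R` (`exists_test_exp_decay`): `supp g ⊆ [-a, a]`,
`ĝ(1/2 + it) = -2i sin((t - h)τ) Φ̂(1/2 + i(t - h))` vanishes on the lattice `h + (π/τ)ℤ`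
(T64 `weilMellin_comb_lattice_eq_zero`), so at a pocket zero the Lipschitz bound
`|ĝ(1/2+iγ) - ĝ(1/2+iγ')| ≤ a√(2a) ‖g‖₂ |γ - γ'|` (T63 `norm_weilMellin_line_sub_le`) gives
`|ĝ(ρ)|² ≤ 2a³u²‖g‖₂²`, while at the far zeros `|γ - h| ≥ R` the decay of `Φ̂` gives
`|ĝ(ρ)|² ≤ 2C(1+R²)e^{-R/C}‖g‖₂²/(1 + (γ-h)²)`.  Under RH these are all the zeros of the explicit
formula, the Cauchy-majorant zero side (T9a `exists_finsum_weilZeroIndex_le_of_kernel_bound`)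
bounds every truncated zero sum by `2A₁ M log(|h|+2)`, and `ε(a) ≤ Re Q(g)/‖g‖₂²`
(`weilGroundEnergy_le_div`, `re_weilQuadratic_le_of_zeroSum_le`).
-/

open Complex Set Filter MeasureTheory Literature.NumberTheory.LFunctions
open scoped Real Topology

namespace Summit.RiemannHypothesis.RiemannHypothesis.Theorems

/-! ## The comb of a test on `[-1, 1]` with `τ ≥ 1`: norms -/

/-- For `supp Φ ⊆ [-1, 1]` and `τ ≥ 1` the two translates in the comb have disjoint supports:
`‖Φ(x + τ) - Φ(x - τ)‖² = ‖Φ(x + τ)‖² + ‖Φ(x - τ)‖²`. -/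
theorem norm_sq_comb_eq {Φ : ℝ → ℂ} (hΦ : IsWeilTest Φ) (hΦs : tsupport Φ ⊆ Icc (-1) 1)
    {τ : ℝ} (hτ : 1 ≤ τ) (x : ℝ) :
    ‖Φ (x + τ) - Φ (x - τ)‖ ^ 2 = ‖Φ (x + τ)‖ ^ 2 + ‖Φ (x - τ)‖ ^ 2 := by
  have hsupp := support_subset_Ioo_of_tsupport_subset_Icc hΦ.1.continuous hΦs
  by_cases h1 : Φ (x + τ) = 0
  · rw [h1, zero_sub, norm_neg, norm_zero]; ring
  · have hx1 : x + τ ∈ Ioo (-1 : ℝ) 1 := hsupp h1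
    have h2 : Φ (x - τ) = 0 := by
      by_contra h2
      have hx2 : x - τ ∈ Ioo (-1 : ℝ) 1 := hsupp h2
      linarith [hx1.2, hx2.1]
    rw [h2, sub_zero, norm_zero]; ring

/-- `‖comb‖₂² = 2 ‖Φ‖₂²` for `supp Φ ⊆ [-1, 1]`, `τ ≥ 1`. -/
theorem integral_norm_sq_comb_eq {Φ : ℝ → ℂ} (hΦ : IsWeilTest Φ) (hΦs : tsupport Φ ⊆ Icc (-1) 1)
    {τ : ℝ} (hτ : 1 ≤ τ) :
    ∫ x, ‖Φ (x + τ) - Φ (x - τ)‖ ^ 2 = 2 * ∫ x, ‖Φ x‖ ^ 2 := by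
  simp_rw [norm_sq_comb_eq hΦ hΦs hτ]
  rw [integral_add (hΦ.integrable_norm_sq.comp_add_right τ)
    (hΦ.integrable_norm_sq.comp_sub_right τ),
    integral_add_right_eq_self (fun x ↦ ‖Φ x‖ ^ 2) τ,
    integral_sub_right_eq_self (fun x ↦ ‖Φ x‖ ^ 2) τ]
  ring

/-- `‖-2i sin θ · z‖² ≤ 4 ‖z‖²`. -/
theorem norm_sq_sin_factor_le (θ : ℝ) (z : ℂ) :
    ‖-(2 * I * (Real.sin θ : ℂ)) * z‖ ^ 2 ≤ 4 * ‖z‖ ^ 2 := by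
  rw [norm_mul, mul_pow, norm_neg, norm_mul, norm_mul, Complex.norm_I, Complex.norm_real,
    Real.norm_eq_abs, Complex.norm_two]
  have h := Real.abs_sin_le_one θ
  have h0 := abs_nonneg (Real.sin θ)
  have hs : (2 * 1 * |Real.sin θ|) ^ 2 ≤ 4 := by nlinarith
  exact mul_le_mul_of_nonneg_right hs (sq_nonneg _)

/-! ## The comb-pocket theorem -/

/-- **Comb pockets force exponentially small energy (RH).** There is `A > 0` such that for all
`a, τ, h, R, u` with `1 ≤ τ`, `τ + 1 ≤ a`, `A ≤ R`, `0 ≤ u`: if every ordinate `γ` of a zero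
`ζ(1/2 + iγ) = 0` with `|γ - h| ≤ R` lies within `u` of the lattice `h + (π/τ)ℤ`, then
`weilGroundEnergy a ≤ A log(|h|+2) (1 + R²) (a³u² + e^{-R/A})`. -/
theorem weilGroundEnergy_le_of_combPocket (hRH : RiemannHypothesis) :
    ∃ A : ℝ, 0 < A ∧ ∀ a τ h R u : ℝ, 1 ≤ τ → τ + 1 ≤ a → A ≤ R → 0 ≤ u →
      (∀ γ : ℝ, riemannZeta (1 / 2 + γ * I) = 0 → |γ - h| ≤ R →
        ∃ k : ℤ, |γ - h - k * π / τ| ≤ u) →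
      weilGroundEnergy a ≤
        A * Real.log (|h| + 2) * (1 + R ^ 2) * (a ^ 3 * u ^ 2 + Real.exp (-(R / A))) := by
  classical
  obtain ⟨C, hC, hdecay⟩ := exists_test_exp_decay
  obtain ⟨A₁, hA₁, hK⟩ := exists_finsum_weilZeroIndex_le_of_kernel_bound
  refine ⟨4 * A₁ * (C + 1) + C, by positivity, fun a τ h R u hτ hτa hR hu hpocket ↦ ?_⟩
  obtain ⟨A, hA⟩ : ∃ A : ℝ, A = 4 * A₁ * (C + 1) + C := ⟨_, rfl⟩
  rw [← hA] at hR ⊢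
  have hCA : C ≤ A := by rw [hA]; nlinarith
  have hRC : C ≤ R := hCA.trans hR
  have hR0 : 0 < R := hC.trans_le hRC
  have hτ0 : 0 < τ := by linarith
  have ha0 : 0 ≤ a := by linarith
  have hlog : 0 < Real.log (|h| + 2) := Real.log_pos (by linarith [abs_nonneg h])
  obtain ⟨Φ, hΦ, hΦs, hEΦ, hfar⟩ := hdecay R hRC
  -- the comb `G` and the twisted comb `g`
  obtain ⟨G, hG⟩ : ∃ G : ℝ → ℂ, G = fun x ↦ Φ (x + τ) - Φ (x - τ) := ⟨_, rfl⟩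
  have hGt : IsWeilTest G := hG ▸ isWeilTest_comb hΦ τ
  have hGs : tsupport G ⊆ Icc (-(1 + τ)) (1 + τ) := hG ▸ tsupport_comb_subset hΦs hτ0.le
  obtain ⟨g, hg⟩ : ∃ g : ℝ → ℂ, g = fun x ↦ G x * cexp (((-h) * x : ℝ) * I) := ⟨_, rfl⟩
  have hgt : IsWeilTest g := hg ▸ isWeilTest_mul_cexp_ofReal_mul_I hGt (-h)
  have hgs : tsupport g ⊆ Icc (-a) a := by
    rw [hg]
    exact (tsupport_mul_cexp_subset G (-h)).trans
      (hGs.trans (Icc_subset_Icc (by linarith) (by linarith)))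
  -- transforms
  have hgm : ∀ y : ℝ, weilMellin g (1 / 2 + y * I) =
      weilMellin G (1 / 2 + ((y - h : ℝ) : ℂ) * I) := by
    intro y
    rw [hg, weilMellin_mul_cexp_ofReal_mul_I_half, ← sub_eq_add_neg]
  have hGm : ∀ s : ℝ, weilMellin G (1 / 2 + s * I) =
      -(2 * I * (Real.sin (s * τ) : ℂ)) * weilMellin Φ (1 / 2 + s * I) := by
    intro s
    rw [hG]
    exact weilMellin_comb hΦ τ s
  have hgnorm : ∀ y : ℝ, ‖weilMellin g (1 / 2 + y * I)‖ ^ 2 ≤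
      4 * ‖weilMellin Φ (1 / 2 + ((y - h : ℝ) : ℂ) * I)‖ ^ 2 := by
    intro y
    rw [hgm, hGm]
    exact norm_sq_sin_factor_le _ _
  have hlat : ∀ k : ℤ, weilMellin g (1 / 2 + ((h + k * π / τ : ℝ) : ℂ) * I) = 0 := by
    intro k
    rw [hgm, add_sub_cancel_left, hG]
    exact weilMellin_comb_lattice_eq_zero hΦ hτ0.ne' k
  -- norms: `‖g‖₂² = ‖G‖₂² = 2 ‖Φ‖₂²`
  obtain ⟨E, hE⟩ : ∃ E : ℝ, E = ∫ x, ‖g x‖ ^ 2 := ⟨_, rfl⟩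
  have hEeq : E = 2 * ∫ x, ‖Φ x‖ ^ 2 := by
    rw [hE, ← integral_norm_sq_comb_eq hΦ hΦs hτ, hG] at *
    rw [hg]
    congr 1 with x
    rw [norm_mul, Complex.norm_exp_ofReal_mul_I, mul_one]
  have hEpos : 0 < E := by rw [hEeq]; positivity
  -- near zeros: Lipschitz from a lattice zero
  have hnear : ∀ γ : ℝ, (∃ k : ℤ, |γ - h - k * π / τ| ≤ u) →
      ‖weilMellin g (1 / 2 + γ * I)‖ ^ 2 ≤ 2 * a ^ 3 * u ^ 2 * E := by
    rintro γ ⟨k, hk⟩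
    have hL := norm_weilMellin_line_sub_le hgt hgs ha0 γ (h + k * π / τ)
    rw [hlat k, sub_zero, ← hE, show γ - (h + k * π / τ) = γ - h - k * π / τ by ring] at hL
    have hK0 : 0 ≤ a * (Real.sqrt (2 * a) * Real.sqrt E) := by positivity
    have h1 : ‖weilMellin g (1 / 2 + γ * I)‖ ≤ a * (Real.sqrt (2 * a) * Real.sqrt E) * u :=
      hL.trans (mul_le_mul_of_nonneg_left hk hK0)
    have h2 := pow_le_pow_left₀ (norm_nonneg _) h1 2
    have h3 : (a * (Real.sqrt (2 * a) * Real.sqrt E) * u) ^ 2 = 2 * a ^ 3 * u ^ 2 * E := by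
      rw [mul_pow, mul_pow, mul_pow, Real.sq_sqrt (by positivity), Real.sq_sqrt hEpos.le]
      ring
    rw [h3] at h2
    exact h2
  -- far zeros: decay of `Φ̂`
  have hfar' : ∀ γ : ℝ, R ≤ |γ - h| →
      ‖weilMellin g (1 / 2 + γ * I)‖ ^ 2 ≤
        2 * C * (1 + R ^ 2) * Real.exp (-(R / C)) * E / (1 + (γ - h) ^ 2) := by
    intro γ hγ
    have h1 := hfar (γ - h) hγ
    rw [le_div_iff₀ (by positivity), hEeq]
    calc ‖weilMellin g (1 / 2 + γ * I)‖ ^ 2 * (1 + (γ - h) ^ 2)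
        ≤ 4 * ‖weilMellin Φ (1 / 2 + ((γ - h : ℝ) : ℂ) * I)‖ ^ 2 * (1 + (γ - h) ^ 2) :=
          mul_le_mul_of_nonneg_right (hgnorm γ) (by positivity)
      _ = 4 * ((1 + (γ - h) ^ 2) * ‖weilMellin Φ (1 / 2 + ((γ - h : ℝ) : ℂ) * I)‖ ^ 2) := by
          ring
      _ ≤ 4 * (C * (1 + R ^ 2) * Real.exp (-(R / C)) * ∫ x, ‖Φ x‖ ^ 2) :=
          mul_le_mul_of_nonneg_left h1 (by norm_num)
      _ = 2 * C * (1 + R ^ 2) * Real.exp (-(R / C)) * (2 * ∫ x, ‖Φ x‖ ^ 2) := by ring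
  -- the Cauchy majorant on the closed strip, under RH
  obtain ⟨M, hM⟩ : ∃ M : ℝ,
      M = (1 + R ^ 2) * E * (2 * a ^ 3 * u ^ 2 + 2 * C * Real.exp (-(R / C))) := ⟨_, rfl⟩
  have hM0 : 0 ≤ M := by rw [hM]; positivity
  obtain ⟨F, hF⟩ : ∃ F : ℂ → ℝ,
      F = fun ρ ↦ if riemannZeta ρ = 0 ∧ ρ.im ≠ 0 then ‖weilMellin g ρ‖ ^ 2 else 0 :=
    ⟨_, rfl⟩
  have hmaj : ∀ ρ : ℂ, 0 ≤ ρ.re → ρ.re ≤ 1 → F ρ ≤ M / (1 + (ρ.im - h) ^ 2) := by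
    intro ρ h0 h1
    rw [hF]
    dsimp only
    split_ifs with hz
    · obtain ⟨hζ, him⟩ := hz
      have hre : ρ.re = 1 / 2 := by
        refine hRH ρ hζ ?_ ?_
        · rintro ⟨n, hn⟩
          have : ρ.im = 0 := by rw [hn]; simp
          exact him this
        · rintro rfl
          simp at him
      have hρ : (1 / 2 : ℂ) + ((ρ.im : ℝ) : ℂ) * I = ρ := by
        apply Complex.ext <;> simp [hre]
      have hζ' : riemannZeta (1 / 2 + (ρ.im : ℝ) * I) = 0 := by rw [hρ]; exact hζ
      have hden : 1 + (ρ.im - h) ^ 2 ≤ 1 + R ^ 2 ∨ R ≤ |ρ.im - h| := by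
        rcases le_or_gt |ρ.im - h| R with hle | hlt
        · left
          have := sq_le_sq' (abs_le.1 hle).1 (abs_le.1 hle).2
          linarith
        · right; exact hlt.le
      rcases le_or_gt |ρ.im - h| R with hle | hlt
      · -- pocket zero
        have hb := hnear ρ.im (hpocket ρ.im hζ' hle)
        rw [hρ] at hb
        rw [le_div_iff₀ (by positivity), hM]
        have hsq : (ρ.im - h) ^ 2 ≤ R ^ 2 := by
          have := abs_le.1 hle
          nlinarith [this.1, this.2]
        have hpos1 : 0 ≤ (1 + R ^ 2) * E * (2 * C * Real.exp (-(R / C))) := by positivity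
        calc ‖weilMellin g ρ‖ ^ 2 * (1 + (ρ.im - h) ^ 2)
            ≤ 2 * a ^ 3 * u ^ 2 * E * (1 + R ^ 2) :=
              mul_le_mul hb (by linarith) (by positivity) (by positivity)
          _ ≤ 2 * a ^ 3 * u ^ 2 * E * (1 + R ^ 2) +
              (1 + R ^ 2) * E * (2 * C * Real.exp (-(R / C))) := le_add_of_nonneg_right hpos1
          _ = (1 + R ^ 2) * E * (2 * a ^ 3 * u ^ 2 + 2 * C * Real.exp (-(R / C))) := by
              ring
      · -- far zero
        have hb := hfar' ρ.im hlt.le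
        rw [hρ] at hb
        refine hb.trans (div_le_div_of_nonneg_right ?_ (by positivity))
        rw [hM]
        have hpos2 : 0 ≤ (1 + R ^ 2) * E * (2 * a ^ 3 * u ^ 2) := by positivity
        calc 2 * C * (1 + R ^ 2) * Real.exp (-(R / C)) * E
            ≤ 2 * C * (1 + R ^ 2) * Real.exp (-(R / C)) * E +
              (1 + R ^ 2) * E * (2 * a ^ 3 * u ^ 2) := le_add_of_nonneg_right hpos2
          _ = (1 + R ^ 2) * E * (2 * a ^ 3 * u ^ 2 + 2 * C * Real.exp (-(R / C))) := by
              ring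
    · positivity
  -- zero sums
  have hZ : ∀ T : ℝ, ∑ᶠ ρ ∈ weilZeroIndex T,
      (riemannZetaZeroOrder ρ : ℝ) * ‖weilMellin g ρ‖ ^ 2 ≤ 2 * A₁ * M * Real.log (|h| + 2) := by
    intro T
    have hcongr : ∑ᶠ ρ ∈ weilZeroIndex T, (riemannZetaZeroOrder ρ : ℝ) * ‖weilMellin g ρ‖ ^ 2 =
        ∑ᶠ ρ ∈ weilZeroIndex T, (riemannZetaZeroOrder ρ : ℝ) * F ρ := by
      refine finsum_mem_congr rfl fun ρ hρ ↦ ?_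
      rw [hF]
      dsimp only
      rw [if_pos ⟨hρ.1, hρ.2.2.2.1⟩]
    rw [hcongr]
    exact hK F M h hM0 hmaj T
  -- conclusion
  have hQ := re_weilQuadratic_le_of_zeroSum_le hgt hZ
  have hε := weilGroundEnergy_le_div hgt hgs (hE ▸ hEpos)
  rw [← hE] at hε
  have hB : (weilQuadratic g).re / E ≤ 2 * A₁ * M * Real.log (|h| + 2) / E :=
    div_le_div_of_nonneg_right hQ hEpos.le
  have hMe : 2 * A₁ * M * Real.log (|h| + 2) / E =
      4 * A₁ * Real.log (|h| + 2) * (1 + R ^ 2) *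
        (a ^ 3 * u ^ 2 + C * Real.exp (-(R / C))) := by
    rw [hM]
    field_simp
    ring
  have hexp : Real.exp (-(R / C)) ≤ Real.exp (-(R / A)) := by
    rw [Real.exp_le_exp, neg_le_neg_iff]
    exact div_le_div_of_nonneg_left hR0.le hC hCA
  have hApos : 0 ≤ A := by rw [hA]; positivity
  have h4A : 4 * A₁ ≤ A := by rw [hA]; nlinarith
  have h4AC : 4 * A₁ * C ≤ A := by rw [hA]; nlinarith
  calc weilGroundEnergy a ≤ (weilQuadratic g).re / E := hε
    _ ≤ 4 * A₁ * Real.log (|h| + 2) * (1 + R ^ 2) *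
        (a ^ 3 * u ^ 2 + C * Real.exp (-(R / C))) := by rw [← hMe]; exact hB
    _ = Real.log (|h| + 2) * (1 + R ^ 2) *
        (4 * A₁ * (a ^ 3 * u ^ 2) + 4 * A₁ * C * Real.exp (-(R / C))) := by ring
    _ ≤ Real.log (|h| + 2) * (1 + R ^ 2) *
        (A * (a ^ 3 * u ^ 2) + A * Real.exp (-(R / A))) := by
        refine mul_le_mul_of_nonneg_left (add_le_add ?_ ?_) (mul_nonneg hlog.le (by positivity))
        · exact mul_le_mul_of_nonneg_right h4A (by positivity)
        · exact mul_le_mul h4AC hexp (by positivity) hApos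
    _ = A * Real.log (|h| + 2) * (1 + R ^ 2) * (a ^ 3 * u ^ 2 + Real.exp (-(R / A))) := by
        ring

end Summit.RiemannHypothesis.RiemannHypothesis.Theorems
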